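import Summits.CriticalPhenomena.PercolationContinuityZ3.Theorems.PercNearOneGluingNoHeavyLowerTailMajorityGluingTypeTable
import HarnessLib

/-!
# The 94-type table of the abstract `(4,3)` programme — typewise facts and the clean certificates
(lane prim-rate, constants-miner 1, gen 27; CLEAN-CERTIFICATES.md §1/§3/§8, CONVEX-BOOTSTRAP.md §1)

Support file for the closed crux `NoHeavyLowerTail` (stmt-CriticalPhenomena-4575), majority-gluing line; companion of
`…MajorityGluingTypeTable` (the definitions).  Every statement here is a finite check over the generated table
`allTypes`, discharged by `decide +kernel` (kernel evaluation; no `native_decide`, no extra axioms):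

* COUNTS: 94 types, 79 non-inert / 15 inert, no duplicates; `e ∈ {−1,0,1}`; `P = {e = 1} = T₁` (5 types),
  `Q = {e = −1} = {v₁ cut, N ≤ 2}` (17 types); sizes of the event classes `T_z` (5), `S_z` (22), all-cut (15),
  `C_g` (4), `P_g` (6); every functional used by the certificates vanishes on the inert types;
* LEMMA B (CLEAN-CERTIFICATES §3): `e = (cut_w − cut₁) + 1[T_w] − 1[v_w cut, v₁ att, N ≤ 2] − 1[Q, v_w cut]`
  (`w = 2,3,4`) and `e = 1[T₁] − 1[Q]`, also in the `combo = 0` shape consumed by the law-level file;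
* the SET FACTS of THEOREM CC (§1): `G_g = C_g ⊔ P_g`; every two-attached type lies in exactly one `C_g`; for the
  twelve relay-root van den Berg–Kahn rows `j = (r, {x,y})`: `B_j ⊆ C_j`, `D_j ⊆ A_j`, `D_j = T_r ⊔ S_r`,
  `A_j ∖ D_j = G_{rz}`, `C_j ∖ B_j = C_{rz}` (`z` the fourth relay); the hub-triple supports `ρ₀^{0zy} = 1[v_z, v_y cut]`,
  `ρ_z^{0zy} = π_{z¬y}`; monotonicity of `u_S`;
* the REDUCED COSTS of the exact clean certificates, integer-scaled, `≤ 0` on all 94 types, with the recorded zero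
  counts (+15 inert zeros): USTAR₁..₄ [59] (gen 25, BENCH l.234), QS1 [38], EIGHTH [37], MIX [32] (gen 25,
  CONVEX-BOOTSTRAP §1), STAR₁..₄ [47, min −2/3] (gen 24, CLEAN-CERTIFICATES §8), R207 [41] (gens 22/23) — the
  «rc ≤ 0 verified in rationals» lines of the lane records, now kernel facts about the combinatorially generated table.

The law-level consequences (THEOREM CC instances) are in `…MajorityGluingTypeTableCertificates`.  No definitions,
no sorries.  [cite: VandenbergHaggstromKahn2005, Thm. 1.3 (p. 6)]
-/

namespace Summit.CriticalPhenomena.PercolationContinuityZ3.Theorems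

namespace HubOnly
namespace TypeTable

open DType

/-! ### Counts -/

/-- There are exactly 94 deterministic types. -/
theorem card_allTypes : allTypes.length = 94 := by decide +kernel

/-- 79 of them are non-inert (at least one relay cut); 15 are inert. -/
theorem card_nonInert : (allTypes.filter fun τ => !τ.inert).length = 79 ∧
    (allTypes.filter fun τ => τ.inert).length = 15 := by decide +kernel

/-- The table has no duplicates. -/
theorem nodup_allTypes : allTypes.Nodup := by decide +kernel

/-- The objective integrand takes values in `{−1, 0, 1}`. -/
theorem eZ_range : ∀ τ ∈ allTypes, τ.eZ = -1 ∨ τ.eZ = 0 ∨ τ.eZ = 1 := by decide +kernel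

/-- `P := {e = +1}` IS the layer event `T₁` (only `v₁` attached), typewise. -/
theorem e_eq_one_iff_T1 : ∀ τ ∈ allTypes, (τ.eZ == 1) = τ.isT 1 := by decide +kernel

/-- `Q := {e = −1} = {v₁ cut, N ≤ 2}`, typewise. -/
theorem e_eq_neg_one_iff : ∀ τ ∈ allTypes, (τ.eZ == -1) = (τ.cut 1 && decide (τ.ncut ≤ 2)) := by
  decide +kernel

/-- `|P| = 5` and `|Q| = 17`. -/
theorem card_P_Q : (allTypes.filter fun τ => τ.eZ == 1).length = 5 ∧
    (allTypes.filter fun τ => τ.eZ == -1).length = 17 := by decide +kernel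

/-- Sizes of the event classes: each `T_z` has 5 types, each `S_z` 22, all-cut 15, each `C_g` 4, each `P_g` 6. -/
theorem card_events : (∀ z ∈ [1, 2, 3, 4], (allTypes.filter fun τ => τ.isT z).length = 5 ∧
      (allTypes.filter fun τ => τ.isS z).length = 22) ∧
    (allTypes.filter fun τ => τ.allCut).length = 15 ∧
    (∀ g ∈ [(1,2),(1,3),(1,4),(2,3),(2,4),(3,4)], (allTypes.filter fun τ => τ.isC g.1 g.2).length = 4 ∧
      (allTypes.filter fun τ => τ.isP g.1 g.2).length = 6) := by decide +kernel

/-! ### Everything the certificates use vanishes on the inert types -/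

/-- On the 15 inert types (all relays attached) the objective, every budget / vdBHK / order row integrand used below,
every isolation indicator `u_S` with `|S| ≥ 3`, and the events `T, S, C, P`, all-cut VANISH — so a law may carry
arbitrary mass there (the lane's programmes simply omit these coordinates). -/
theorem inert_silent : ∀ τ ∈ allTypes, τ.inert = true →
    τ.eZ = 0 ∧ (∀ x ∈ [2, 3, 4], τ.bud x = 0 ∧ τ.calone x = 0 ∧ τ.cnotfull x = 0 ∧ τ.cnotalone x = 0 ∧
      (∀ y ∈ [2, 3, 4], τ.caloneY x y = 0)) ∧ τ.ctriple = 0 ∧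
    (∀ p ∈ [(2,3),(2,4),(3,4)], τ.cpair p.1 p.2 = 0 ∧ τ.oalone p.1 p.2 = 0 ∧ τ.oupany p.1 p.2 = 0 ∧
      τ.odnboth p.1 p.2 = 0 ∧ τ.oupboth p.1 p.2 = 0 ∧ (∀ z ∈ [1, 2, 3, 4], τ.odn z p.1 p.2 = 0 ∧ τ.oup z p.1 p.2 = 0)) ∧
    (∀ S ∈ [[0,1,2],[0,1,3],[0,1,4],[0,2,3],[0,2,4],[0,3,4],[1,2,3],[1,2,4],[1,3,4],[2,3,4],
        [0,1,2,3],[0,1,2,4],[0,1,3,4],[0,2,3,4],[1,2,3,4],[0,1,2,3,4]], τ.uZ S = 0) ∧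
    (∀ z ∈ [1, 2, 3, 4], τ.isT z = false ∧ τ.isS z = false ∧ (∀ v ∈ [1, 2, 3, 4], τ.isC z v = false ∧ τ.isP z v = false)) ∧
    τ.allCut = false := by decide +kernel

/-! ### LEMMA B (budget identities, CLEAN-CERTIFICATES §3) -/

/-- **LEMMA B**, typewise for `w = 2,3,4`:
`e = (cut_w − cut₁) + 1[T_w] − 1[v_w cut, v₁ attached, N ≤ 2] − 1[e = −1, v_w cut]`. -/
theorem lemmaB : ∀ τ ∈ allTypes, ∀ w ∈ [2, 3, 4],
    τ.eZ = τ.bud w + ind (τ.isT w) - ind (τ.cut w && τ.att 1 && decide (τ.ncut ≤ 2))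
      - ind (τ.eZ == -1 && τ.cut w) := by decide +kernel

/-- LEMMA B as three typewise identities `combo = 0` (the shape consumed by `cc_eq` in `…TypeTableCertificates`). -/
theorem lemmaB_combo : ∀ τ ∈ allTypes, ∀ w ∈ [2, 3, 4],
    combo [(1, eZ), (-1, fun τ => τ.bud w), (-1, fun τ => ind (τ.isT w)),
      (1, fun τ => ind (τ.cut w && τ.att 1 && decide (τ.ncut ≤ 2))), (1, fun τ => ind (τ.eZ == -1 && τ.cut w))] τ
      = 0 := by decide +kernel

/-- `e = 1[T₁] − 1[Q]` typewise (`Q = {e = −1}`), as `combo = 0`. -/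
theorem lemmaB_one_combo : ∀ τ ∈ allTypes,
    combo [(1, eZ), (-1, fun τ => ind (τ.isT 1)), (1, fun τ => ind (τ.eZ == -1))] τ = 0 := by decide +kernel

/-! ### The set facts of THEOREM CC (CLEAN-CERTIFICATES §1) -/

/-- `G_g = C_g ⊔ P_g` for all six pairs, typewise (disjoint union). -/
theorem isG_eq : ∀ τ ∈ allTypes, ∀ w ∈ [1, 2, 3, 4], ∀ v ∈ [1, 2, 3, 4], w ≠ v →
    τ.isG w v = (τ.isC w v || τ.isP w v) ∧ (τ.isC w v && τ.isP w v) = false := by decide +kernel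

/-- The events `C_g`, `P_g`, `G_g` are symmetric in the pair. -/
theorem pair_symm : ∀ τ ∈ allTypes, ∀ w ∈ [1, 2, 3, 4], ∀ v ∈ [1, 2, 3, 4],
    τ.isC w v = τ.isC v w ∧ τ.isP w v = τ.isP v w ∧ τ.isG w v = τ.isG v w := by decide +kernel

/-- Every type with exactly two attached relays lies in exactly one hub-pair event `C_g`. -/
theorem natt_two_unique_C : ∀ τ ∈ allTypes, τ.natt = 2 →
    (([(1,2),(1,3),(1,4),(2,3),(2,4),(3,4)] : List (ℕ × ℕ)).filter fun g => τ.isC g.1 g.2).length = 1 := by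
  decide +kernel

/-- THEOREM CC set facts for the twelve relay-root pair rows `j = (r, {x,y})`, typewise: `B_j ⊆ C_j`, `D_j ⊆ A_j`,
`D_j = T_r ⊔ S_r`, `A_j ∖ D_j = G_{r,z}` and `C_j ∖ B_j = C_{r,z}`, with `z` the fourth relay. -/
theorem relayRoot_sets : ∀ τ ∈ allTypes, ∀ r ∈ [1, 2, 3, 4], ∀ x ∈ [1, 2, 3, 4], ∀ y ∈ [1, 2, 3, 4],
    r ≠ x → r ≠ y → x < y →
    (τ.isBj r = true → τ.isCj r x y = true) ∧ (τ.isD r = true → τ.isA r x y = true) ∧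
    τ.isD r = (τ.isT r || τ.isS r) ∧ (τ.isT r && τ.isS r) = false ∧
    (τ.isA r x y && !τ.isD r) = τ.isG r (10 - r - x - y) ∧
    (τ.isCj r x y && !τ.isBj r) = τ.isC r (10 - r - x - y) := by decide +kernel

/-- The same, in the `combo = 0` shape: `1[A_j] = 1[G_{r,z}] + 1[D_r]`, `1[C_j] = 1[C_{r,z}] + 1[B_j]`,
`1[D_r] = 1[T_r] + 1[S_r]`. -/
theorem relayRoot_combo : ∀ τ ∈ allTypes, ∀ r ∈ [1, 2, 3, 4], ∀ x ∈ [1, 2, 3, 4], ∀ y ∈ [1, 2, 3, 4],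
    r ≠ x → r ≠ y → x < y →
    combo [(1, fun τ => ind (τ.isA r x y)), (-1, fun τ => ind (τ.isG r (10 - r - x - y))), (-1, fun τ => ind (τ.isD r))] τ
        = 0 ∧
    combo [(1, fun τ => ind (τ.isCj r x y)), (-1, fun τ => ind (τ.isC r (10 - r - x - y))), (-1, fun τ => ind (τ.isBj r))] τ
        = 0 ∧
    combo [(1, fun τ => ind (τ.isD r)), (-1, fun τ => ind (τ.isT r)), (-1, fun τ => ind (τ.isS r))] τ = 0 := by
  decide +kernel

/-- The hub point's support in a hub triple: `ρ₀^{0zy} = 1[v_z, v_y both cut]` (bounded by the budget), and the relay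
support `ρ_z^{0zy} = π_{z¬y} := 1[v_z cut, v_z ≁ v_y]` (LEMMA J (J3)), typewise. -/
theorem hubTriple_supports : ∀ τ ∈ allTypes, ∀ z ∈ [1, 2, 3, 4], ∀ y ∈ [1, 2, 3, 4], z ≠ y →
    τ.rho [0, z, y] 0 = (τ.cut z && τ.cut y) ∧ τ.rho [0, z, y] z = (τ.cut z && τ.sep z y) := by decide +kernel

/-- `u_S = 1[S pairwise separated]` is monotone under removing a point, and the four-relay indicator `u₁₂₃₄` implies
every relay-triple indicator (used when caps are traded between ISO subsets). -/
theorem uB_mono : ∀ τ ∈ allTypes,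
    (τ.uB [1, 2, 3, 4] = true → τ.uB [1, 2, 3] = true ∧ τ.uB [1, 2, 4] = true ∧ τ.uB [1, 3, 4] = true ∧
      τ.uB [2, 3, 4] = true) ∧
    (τ.uB [0, 1, 2, 3, 4] = true → τ.uB [1, 2, 3, 4] = true ∧ τ.allCut = true) := by decide +kernel

/-! ### The clean certificates: reduced costs `rc ≤ 0` on all 94 types (integer-scaled)

A clean certificate (CLEAN-CERTIFICATES §1) is `p = (λ ≥ 0` on linear rows, `κ_S ≥ 0` on ISO subsets, per glued pair
`g`: `α_g`, `β_g ≥ 0)` with `rc_p(τ) := e(τ) − Σλ_k feat_k(τ) − Σκ_S u_S(τ) + Σ_g(α_g 1[τ ∈ C_g] − β_g 1[τ ∈ P_g]) ≤ 0`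
for every type.  Below `d·rc_p` with the common denominator `d` cleared, as a `combo`; the zero counts are those of
the lane records plus the 15 inert types (on which `rc = 0`). -/

/-- **USTAR₁** (gen 25, BENCH l.234; `d = 2`): `κ(u₂₃₄) = ½`, `α = 1` on `{1,2},{1,3},{1,4}`, `λ(B₂) = 1`,
`λ(O_dn4_23) = λ(O_up4_23) = ½`.  59 + 15 zeros. -/
theorem rc_USTAR1 : ∀ τ ∈ allTypes,
    combo [(2, eZ), (-2, fun τ => τ.bud 2), (-1, fun τ => τ.odn 4 2 3), (-1, fun τ => τ.oup 4 2 3),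
      (-1, fun τ => τ.uZ [2, 3, 4]), (2, fun τ => ind (τ.isC 1 2)), (2, fun τ => ind (τ.isC 1 3)),
      (2, fun τ => ind (τ.isC 1 4))] τ ≤ 0 := by decide +kernel

/-- The variant of USTAR₁ with `O_dn3_24` in place of `O_up4_23` is equally valid. -/
theorem rc_USTAR1' : ∀ τ ∈ allTypes,
    combo [(2, eZ), (-2, fun τ => τ.bud 2), (-1, fun τ => τ.odn 4 2 3), (-1, fun τ => τ.odn 3 2 4),
      (-1, fun τ => τ.uZ [2, 3, 4]), (2, fun τ => ind (τ.isC 1 2)), (2, fun τ => ind (τ.isC 1 3)),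
      (2, fun τ => ind (τ.isC 1 4))] τ ≤ 0 := by decide +kernel

/-- **USTAR₂** (`d = 2`): `κ(u₁₃₄) = ½`, `α = 1` on `{1,2},{2,3},{2,4}`, `λ(Cpair_34) = λ(CaloneY_3_2) = ½`. -/
theorem rc_USTAR2 : ∀ τ ∈ allTypes,
    combo [(2, eZ), (-1, fun τ => τ.cpair 3 4), (-1, fun τ => τ.caloneY 3 2), (-1, fun τ => τ.uZ [1, 3, 4]),
      (2, fun τ => ind (τ.isC 1 2)), (2, fun τ => ind (τ.isC 2 3)), (2, fun τ => ind (τ.isC 2 4))] τ ≤ 0 := by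
  decide +kernel

/-- **USTAR₃** (`d = 2`): `κ(u₁₂₄) = ½`, `α = 1` on `{1,3},{2,3},{3,4}`, `λ(Cpair_24) = λ(CaloneY_2_3) = ½`. -/
theorem rc_USTAR3 : ∀ τ ∈ allTypes,
    combo [(2, eZ), (-1, fun τ => τ.cpair 2 4), (-1, fun τ => τ.caloneY 2 3), (-1, fun τ => τ.uZ [1, 2, 4]),
      (2, fun τ => ind (τ.isC 1 3)), (2, fun τ => ind (τ.isC 2 3)), (2, fun τ => ind (τ.isC 3 4))] τ ≤ 0 := by
  decide +kernel

/-- **USTAR₄** (`d = 2`): `κ(u₁₂₃) = ½`, `α = 1` on `{1,4},{2,4},{3,4}`, `λ(Cpair_23) = λ(CaloneY_2_4) = ½`. -/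
theorem rc_USTAR4 : ∀ τ ∈ allTypes,
    combo [(2, eZ), (-1, fun τ => τ.cpair 2 3), (-1, fun τ => τ.caloneY 2 4), (-1, fun τ => τ.uZ [1, 2, 3]),
      (2, fun τ => ind (τ.isC 1 4)), (2, fun τ => ind (τ.isC 2 4)), (2, fun τ => ind (τ.isC 3 4))] τ ≤ 0 := by
  decide +kernel

/-- The recorded zero counts of USTAR₁..₄: 59 non-inert + 15 inert = 74 each. -/
theorem zeros_USTAR :
    zeroCount (combo [(2, eZ), (-2, fun τ => τ.bud 2), (-1, fun τ => τ.odn 4 2 3), (-1, fun τ => τ.oup 4 2 3),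
      (-1, fun τ => τ.uZ [2, 3, 4]), (2, fun τ => ind (τ.isC 1 2)), (2, fun τ => ind (τ.isC 1 3)),
      (2, fun τ => ind (τ.isC 1 4))]) = 74 ∧
    zeroCount (combo [(2, eZ), (-1, fun τ => τ.cpair 3 4), (-1, fun τ => τ.caloneY 3 2),
      (-1, fun τ => τ.uZ [1, 3, 4]), (2, fun τ => ind (τ.isC 1 2)), (2, fun τ => ind (τ.isC 2 3)),
      (2, fun τ => ind (τ.isC 2 4))]) = 74 := by decide +kernel

/-- **QS1** (gen 25; `d = 16`): `κ = 1/16` on the four relay triples, `α_g = 3/8` on all six pairs, rows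
`B₂ ¼, B₃ ⅛, Calone₂,₃,₄ 1/16, Cpair_34 ⅛, Cnotfull₂,₃,₄ 1/16, Cnotalone₂ ⅛, O_alone/O_upany of 23, 24, 34 1/16`.
38 + 15 zeros. -/
theorem rc_QS1 : (∀ τ ∈ allTypes,
    combo [(16, eZ), (-4, fun τ => τ.bud 2), (-2, fun τ => τ.bud 3),
      (-1, fun τ => τ.calone 2), (-1, fun τ => τ.calone 3), (-1, fun τ => τ.calone 4),
      (-2, fun τ => τ.cpair 3 4), (-1, fun τ => τ.cnotfull 2), (-1, fun τ => τ.cnotfull 3),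
      (-1, fun τ => τ.cnotfull 4), (-2, fun τ => τ.cnotalone 2),
      (-1, fun τ => τ.oalone 2 3), (-1, fun τ => τ.oalone 2 4), (-1, fun τ => τ.oalone 3 4),
      (-1, fun τ => τ.oupany 2 3), (-1, fun τ => τ.oupany 2 4), (-1, fun τ => τ.oupany 3 4),
      (-1, fun τ => τ.uZ [1, 2, 3]), (-1, fun τ => τ.uZ [1, 2, 4]), (-1, fun τ => τ.uZ [1, 3, 4]),
      (-1, fun τ => τ.uZ [2, 3, 4]),
      (6, fun τ => ind (τ.isC 1 2)), (6, fun τ => ind (τ.isC 1 3)), (6, fun τ => ind (τ.isC 1 4)),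
      (6, fun τ => ind (τ.isC 2 3)), (6, fun τ => ind (τ.isC 2 4)), (6, fun τ => ind (τ.isC 3 4))] τ ≤ 0) ∧
    zeroCount (combo [(16, eZ), (-4, fun τ => τ.bud 2), (-2, fun τ => τ.bud 3),
      (-1, fun τ => τ.calone 2), (-1, fun τ => τ.calone 3), (-1, fun τ => τ.calone 4),
      (-2, fun τ => τ.cpair 3 4), (-1, fun τ => τ.cnotfull 2), (-1, fun τ => τ.cnotfull 3),
      (-1, fun τ => τ.cnotfull 4), (-2, fun τ => τ.cnotalone 2),
      (-1, fun τ => τ.oalone 2 3), (-1, fun τ => τ.oalone 2 4), (-1, fun τ => τ.oalone 3 4),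
      (-1, fun τ => τ.oupany 2 3), (-1, fun τ => τ.oupany 2 4), (-1, fun τ => τ.oupany 3 4),
      (-1, fun τ => τ.uZ [1, 2, 3]), (-1, fun τ => τ.uZ [1, 2, 4]), (-1, fun τ => τ.uZ [1, 3, 4]),
      (-1, fun τ => τ.uZ [2, 3, 4]),
      (6, fun τ => ind (τ.isC 1 2)), (6, fun τ => ind (τ.isC 1 3)), (6, fun τ => ind (τ.isC 1 4)),
      (6, fun τ => ind (τ.isC 2 3)), (6, fun τ => ind (τ.isC 2 4)), (6, fun τ => ind (τ.isC 3 4))]) = 53 := by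
  decide +kernel

/-- **EIGHTH** (gen 25; `d = 8`): `κ = ⅛` on `u₁₂₃, u₁₂₄`, rows `B₂ = Calone₂ = ¼`,
`Calone₃ = Calone₄ = Ctriple = Cnotalone₂ = O_alone_23 = O_alone_24 = ⅛`, no pair multipliers.  37 + 15 zeros. -/
theorem rc_EIGHTH : (∀ τ ∈ allTypes,
    combo [(8, eZ), (-2, fun τ => τ.bud 2), (-2, fun τ => τ.calone 2), (-1, fun τ => τ.calone 3),
      (-1, fun τ => τ.calone 4), (-1, ctriple), (-1, fun τ => τ.cnotalone 2), (-1, fun τ => τ.oalone 2 3),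
      (-1, fun τ => τ.oalone 2 4), (-1, fun τ => τ.uZ [1, 2, 3]), (-1, fun τ => τ.uZ [1, 2, 4])] τ ≤ 0) ∧
    zeroCount (combo [(8, eZ), (-2, fun τ => τ.bud 2), (-2, fun τ => τ.calone 2), (-1, fun τ => τ.calone 3),
      (-1, fun τ => τ.calone 4), (-1, ctriple), (-1, fun τ => τ.cnotalone 2), (-1, fun τ => τ.oalone 2 3),
      (-1, fun τ => τ.oalone 2 4), (-1, fun τ => τ.uZ [1, 2, 3]), (-1, fun τ => τ.uZ [1, 2, 4])]) = 52 := by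
  decide +kernel

/-- **MIX** (gen 25; `d = 24`): `κ(u₁₂₃₄) = 1/12`, `κ = 1/24` on the four relay triples, rows `B₂ ⅓, B₃ ⅙,
Calone_x = Cnotalone_x = O_alone_xy = O_upany_xy = 1/12`, no pair multipliers.  32 + 15 zeros. -/
theorem rc_MIX : (∀ τ ∈ allTypes,
    combo [(24, eZ), (-8, fun τ => τ.bud 2), (-4, fun τ => τ.bud 3),
      (-2, fun τ => τ.calone 2), (-2, fun τ => τ.calone 3), (-2, fun τ => τ.calone 4),
      (-2, fun τ => τ.cnotalone 2), (-2, fun τ => τ.cnotalone 3), (-2, fun τ => τ.cnotalone 4),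
      (-2, fun τ => τ.oalone 2 3), (-2, fun τ => τ.oalone 2 4), (-2, fun τ => τ.oalone 3 4),
      (-2, fun τ => τ.oupany 2 3), (-2, fun τ => τ.oupany 2 4), (-2, fun τ => τ.oupany 3 4),
      (-2, fun τ => τ.uZ [1, 2, 3, 4]), (-1, fun τ => τ.uZ [1, 2, 3]), (-1, fun τ => τ.uZ [1, 2, 4]),
      (-1, fun τ => τ.uZ [1, 3, 4]), (-1, fun τ => τ.uZ [2, 3, 4])] τ ≤ 0) ∧
    zeroCount (combo [(24, eZ), (-8, fun τ => τ.bud 2), (-4, fun τ => τ.bud 3),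
      (-2, fun τ => τ.calone 2), (-2, fun τ => τ.calone 3), (-2, fun τ => τ.calone 4),
      (-2, fun τ => τ.cnotalone 2), (-2, fun τ => τ.cnotalone 3), (-2, fun τ => τ.cnotalone 4),
      (-2, fun τ => τ.oalone 2 3), (-2, fun τ => τ.oalone 2 4), (-2, fun τ => τ.oalone 3 4),
      (-2, fun τ => τ.oupany 2 3), (-2, fun τ => τ.oupany 2 4), (-2, fun τ => τ.oupany 3 4),
      (-2, fun τ => τ.uZ [1, 2, 3, 4]), (-1, fun τ => τ.uZ [1, 2, 3]), (-1, fun τ => τ.uZ [1, 2, 4]),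
      (-1, fun τ => τ.uZ [1, 3, 4]), (-1, fun τ => τ.uZ [2, 3, 4])]) = 47 := by
  decide +kernel

/-- **STAR₁** (gen 24, CLEAN-CERTIFICATES §8; `d = 3`): `κ(u₁₂₃₄) = ⅓`, `(α, β) = (⅔, ⅓)` on the pairs `∋ 1`,
rows `B₂ = 1`, `O_dn4_23 = O_up4_23 = O_dn3_24 = ⅓`.  47 + 15 zeros, minimum `−2/3`. -/
theorem rc_STAR1 : (∀ τ ∈ allTypes,
    combo [(3, eZ), (-3, fun τ => τ.bud 2), (-1, fun τ => τ.odn 4 2 3), (-1, fun τ => τ.oup 4 2 3),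
      (-1, fun τ => τ.odn 3 2 4), (-1, fun τ => τ.uZ [1, 2, 3, 4]),
      (2, fun τ => ind (τ.isC 1 2)), (2, fun τ => ind (τ.isC 1 3)), (2, fun τ => ind (τ.isC 1 4)),
      (-1, fun τ => ind (τ.isP 1 2)), (-1, fun τ => ind (τ.isP 1 3)), (-1, fun τ => ind (τ.isP 1 4))] τ ≤ 0) ∧
    (∀ τ ∈ allTypes, -2 ≤
    combo [(3, eZ), (-3, fun τ => τ.bud 2), (-1, fun τ => τ.odn 4 2 3), (-1, fun τ => τ.oup 4 2 3),
      (-1, fun τ => τ.odn 3 2 4), (-1, fun τ => τ.uZ [1, 2, 3, 4]),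
      (2, fun τ => ind (τ.isC 1 2)), (2, fun τ => ind (τ.isC 1 3)), (2, fun τ => ind (τ.isC 1 4)),
      (-1, fun τ => ind (τ.isP 1 2)), (-1, fun τ => ind (τ.isP 1 3)), (-1, fun τ => ind (τ.isP 1 4))] τ) ∧
    zeroCount (combo [(3, eZ), (-3, fun τ => τ.bud 2), (-1, fun τ => τ.odn 4 2 3), (-1, fun τ => τ.oup 4 2 3),
      (-1, fun τ => τ.odn 3 2 4), (-1, fun τ => τ.uZ [1, 2, 3, 4]),
      (2, fun τ => ind (τ.isC 1 2)), (2, fun τ => ind (τ.isC 1 3)), (2, fun τ => ind (τ.isC 1 4)),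
      (-1, fun τ => ind (τ.isP 1 2)), (-1, fun τ => ind (τ.isP 1 3)), (-1, fun τ => ind (τ.isP 1 4))]) = 62 := by
  decide +kernel

/-- **STAR₂** (`d = 3`): `κ(u₁₂₃₄) = ⅓`, `(α, β) = (⅔, ⅓)` on the pairs `∋ 2`, rows `Cpair_34, CaloneY_3_2, CaloneY_4_2 = ⅓`. -/
theorem rc_STAR2 : ∀ τ ∈ allTypes,
    combo [(3, eZ), (-1, fun τ => τ.cpair 3 4), (-1, fun τ => τ.caloneY 3 2), (-1, fun τ => τ.caloneY 4 2),
      (-1, fun τ => τ.uZ [1, 2, 3, 4]),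
      (2, fun τ => ind (τ.isC 2 1)), (2, fun τ => ind (τ.isC 2 3)), (2, fun τ => ind (τ.isC 2 4)),
      (-1, fun τ => ind (τ.isP 2 1)), (-1, fun τ => ind (τ.isP 2 3)), (-1, fun τ => ind (τ.isP 2 4))] τ ≤ 0 := by
  decide +kernel

/-- **STAR₃** (`d = 3`): rows `Cpair_24, CaloneY_2_3, CaloneY_4_3 = ⅓`, pairs `∋ 3`. -/
theorem rc_STAR3 : ∀ τ ∈ allTypes,
    combo [(3, eZ), (-1, fun τ => τ.cpair 2 4), (-1, fun τ => τ.caloneY 2 3), (-1, fun τ => τ.caloneY 4 3),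
      (-1, fun τ => τ.uZ [1, 2, 3, 4]),
      (2, fun τ => ind (τ.isC 3 1)), (2, fun τ => ind (τ.isC 3 2)), (2, fun τ => ind (τ.isC 3 4)),
      (-1, fun τ => ind (τ.isP 3 1)), (-1, fun τ => ind (τ.isP 3 2)), (-1, fun τ => ind (τ.isP 3 4))] τ ≤ 0 := by
  decide +kernel

/-- **STAR₄** (`d = 3`): rows `Cpair_23, CaloneY_2_4, CaloneY_3_4 = ⅓`, pairs `∋ 4`. -/
theorem rc_STAR4 : ∀ τ ∈ allTypes,
    combo [(3, eZ), (-1, fun τ => τ.cpair 2 3), (-1, fun τ => τ.caloneY 2 4), (-1, fun τ => τ.caloneY 3 4),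
      (-1, fun τ => τ.uZ [1, 2, 3, 4]),
      (2, fun τ => ind (τ.isC 4 1)), (2, fun τ => ind (τ.isC 4 2)), (2, fun τ => ind (τ.isC 4 3)),
      (-1, fun τ => ind (τ.isP 4 1)), (-1, fun τ => ind (τ.isP 4 2)), (-1, fun τ => ind (τ.isP 4 3))] τ ≤ 0 := by
  decide +kernel

/-- **R207** (gens 22/23; `d = 4`; its reduced costs are `r`-free): `λ = ¼` on `Ctriple, Cnotfull₂,₃,₄`,
`κ(u₁₂₃₄) = ¼`, `(α, β) = (½, ¼)` on all six pairs.  41 + 15 zeros. -/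
theorem rc_R207 : (∀ τ ∈ allTypes,
    combo [(4, eZ), (-1, ctriple), (-1, fun τ => τ.cnotfull 2), (-1, fun τ => τ.cnotfull 3),
      (-1, fun τ => τ.cnotfull 4), (-1, fun τ => τ.uZ [1, 2, 3, 4]),
      (2, fun τ => ind (τ.isC 1 2)), (2, fun τ => ind (τ.isC 1 3)), (2, fun τ => ind (τ.isC 1 4)),
      (2, fun τ => ind (τ.isC 2 3)), (2, fun τ => ind (τ.isC 2 4)), (2, fun τ => ind (τ.isC 3 4)),
      (-1, fun τ => ind (τ.isP 1 2)), (-1, fun τ => ind (τ.isP 1 3)), (-1, fun τ => ind (τ.isP 1 4)),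
      (-1, fun τ => ind (τ.isP 2 3)), (-1, fun τ => ind (τ.isP 2 4)), (-1, fun τ => ind (τ.isP 3 4))] τ ≤ 0) ∧
    zeroCount (combo [(4, eZ), (-1, ctriple), (-1, fun τ => τ.cnotfull 2), (-1, fun τ => τ.cnotfull 3),
      (-1, fun τ => τ.cnotfull 4), (-1, fun τ => τ.uZ [1, 2, 3, 4]),
      (2, fun τ => ind (τ.isC 1 2)), (2, fun τ => ind (τ.isC 1 3)), (2, fun τ => ind (τ.isC 1 4)),
      (2, fun τ => ind (τ.isC 2 3)), (2, fun τ => ind (τ.isC 2 4)), (2, fun τ => ind (τ.isC 3 4)),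
      (-1, fun τ => ind (τ.isP 1 2)), (-1, fun τ => ind (τ.isP 1 3)), (-1, fun τ => ind (τ.isP 1 4)),
      (-1, fun τ => ind (τ.isP 2 3)), (-1, fun τ => ind (τ.isP 2 4)), (-1, fun τ => ind (τ.isP 3 4))]) = 56 := by
  decide +kernel

end TypeTable
end HubOnly

end Summit.CriticalPhenomena.PercolationContinuityZ3.Theorems
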